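import Literature.Topology.FourManifolds.FishtailTubeDZeroNorth
import Literature.Topology.FourManifolds.GluedDesc
import HarnessLib

/-!
# Invariants of points of the mapping torus of the tube shear

Infrastructure for the explicit fishtail neighbourhood (R. Gompf, *More Cappell–Shaneson spheres
are standard*, Algebr. Geom. Topol. 10 (2010), proof of Thm 2.1 and Lemma 2.2; the named fact
`Literature.Topology.FourManifolds.gompf2010_framedTwist`). The tube shear `ψ₀` preserves the
fibre coordinate `z₂` and the latitude `z₁ z₃` of `T³`; hence three circle-valued functions on
the mapping torus `X = MTorus ψ₀` are well defined on both cylinders: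

* `latC [x, s] = z₁ z₃`, `yC [x, s] = z₂`, `baseC [x, s] = e^{2πis}`;

with their values on the points `mtPt x s` and `mtCoord (v, s)` (`0 < s < 3/2`), and the
injectivity of `[x, s]` for `s ∈ [1/2, 3/2)` (`mtPt_inj_Ico`). These invariants drive the
injectivity proofs of the fishtail end map.

Everything is proved; no named facts.

## References

* R. E. Gompf, *More Cappell–Shaneson spheres are standard*, Algebr. Geom. Topol. 10 (2010)
  1665–1681, proof of Thm 2.1 and Lemma 2.2. [GompfAGT2010]
-/

noncomputable section

open scoped Real Topology Manifold ContDiff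
open Set Complex

namespace Literature.Topology.FourManifolds

local notation "𝔼 " n:arg => EuclideanSpace ℝ (Fin n)

/-! ### The tube shear preserves `z₂` and `z₁ z₃` -/

/-- The tube shear preserves `z₂`. [folklore] -/
@[simp] theorem tubeShearDiffeo_snd_fst (z : ThreeTorus) : (tubeShearDiffeo z).2.1 = z.2.1 := rfl

/-- The tube shear preserves the latitude `z₁ z₃`. [folklore] -/
theorem tubeShearDiffeo_fst_mul (z : ThreeTorus) : (tubeShearDiffeo z).1 * (tubeShearDiffeo z).2.2 = z.1 * z.2.2 :=
  tubeShear_fst_mul z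

/-! ### The three invariants -/

/-- **The latitude `z₁ z₃` of a point of the mapping torus of the tube shear.** [folklore] -/
def latC : MTorus tubeShearDiffeo → Circle :=
  (mtGlueData tubeShearDiffeo).desc (fun a ↦ a.1.1 * a.1.2.2) (fun b ↦ b.1.1 * b.1.2.2) fun a ha ↦ by
    have ha' : (a.2 : ℝ) ≠ 1 / 2 := ha
    change a.1.1 * a.1.2.2 = (mtGlueFun tubeShearDiffeo a).1.1 * (mtGlueFun tubeShearDiffeo a).1.2.2
    rcases ha'.lt_or_gt with h | h
    · rw [mtGlueFun_of_lt h]; exact (tubeShearDiffeo_fst_mul a.1).symm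
    · rw [mtGlueFun_of_gt h]

/-- **The fibre coordinate `z₂` of a point of the mapping torus.** [folklore] -/
def yC : MTorus tubeShearDiffeo → Circle :=
  (mtGlueData tubeShearDiffeo).desc (fun a ↦ a.1.2.1) (fun b ↦ b.1.2.1) fun a ha ↦ by
    have ha' : (a.2 : ℝ) ≠ 1 / 2 := ha
    change a.1.2.1 = (mtGlueFun tubeShearDiffeo a).1.2.1
    rcases ha'.lt_or_gt with h | h
    · rw [mtGlueFun_of_lt h]; exact (tubeShearDiffeo_snd_fst a.1).symm
    · rw [mtGlueFun_of_gt h]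

/-- **The base angle `e^{2πis}` of a point of the mapping torus.** [folklore] -/
def baseC : MTorus tubeShearDiffeo → Circle :=
  (mtGlueData tubeShearDiffeo).desc (fun a ↦ Circle.exp (2 * π * (a.2 : ℝ))) (fun b ↦ Circle.exp (2 * π * (b.2 : ℝ)))
    fun a ha ↦ by
    have ha' : (a.2 : ℝ) ≠ 1 / 2 := ha
    change Circle.exp (2 * π * (a.2 : ℝ)) = Circle.exp (2 * π * ((mtGlueFun tubeShearDiffeo a).2 : ℝ))
    rcases ha'.lt_or_gt with h | h
    · rw [mtGlueFun_of_lt h]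
      show Circle.exp (2 * π * (a.2 : ℝ)) = Circle.exp (2 * π * ((a.2 : ℝ) + 1))
      rw [mul_add, mul_one, Circle.exp_add, Circle.exp_two_pi, mul_one]
    · rw [mtGlueFun_of_gt h]

/-- Value of the latitude on the first cylinder. [folklore] -/
@[simp] theorem latC_inl (a : ThreeTorus × ↥mappingTorusPieceOne) : latC ((mtGlueData tubeShearDiffeo).inl a) = a.1.1 * a.1.2.2 := rfl
/-- Value of the latitude on the second cylinder. [folklore] -/
@[simp] theorem latC_inr (b : ThreeTorus × ↥mappingTorusPieceTwo) : latC ((mtGlueData tubeShearDiffeo).inr b) = b.1.1 * b.1.2.2 := rfl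
/-- Value of the fibre coordinate on the first cylinder. [folklore] -/
@[simp] theorem yC_inl (a : ThreeTorus × ↥mappingTorusPieceOne) : yC ((mtGlueData tubeShearDiffeo).inl a) = a.1.2.1 := rfl
/-- Value of the fibre coordinate on the second cylinder. [folklore] -/
@[simp] theorem yC_inr (b : ThreeTorus × ↥mappingTorusPieceTwo) : yC ((mtGlueData tubeShearDiffeo).inr b) = b.1.2.1 := rfl
/-- Value of the base angle on the first cylinder. [folklore] -/
@[simp] theorem baseC_inl (a : ThreeTorus × ↥mappingTorusPieceOne) :
    baseC ((mtGlueData tubeShearDiffeo).inl a) = Circle.exp (2 * π * (a.2 : ℝ)) := rfl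
/-- Value of the base angle on the second cylinder. [folklore] -/
@[simp] theorem baseC_inr (b : ThreeTorus × ↥mappingTorusPieceTwo) :
    baseC ((mtGlueData tubeShearDiffeo).inr b) = Circle.exp (2 * π * (b.2 : ℝ)) := rfl

/-- **The invariants of `[x, s]`** for `0 < s < 3/2`. [folklore] -/
theorem latC_mtPt (x : ThreeTorus) {s : ℝ} (hs0 : 0 < s) (hs1 : s < 3 / 2) : latC (mtPt tubeShearDiffeo x s) = x.1 * x.2.2 := by
  by_cases h : 1 / 2 < s
  · rw [mtPt_of_mem_two x ⟨h, hs1⟩]; rfl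
  · rw [mtPt_of_mem_one x ⟨hs0, by linarith⟩]; rfl

/-- The fibre coordinate of `[x, s]`. [folklore] -/
theorem yC_mtPt (x : ThreeTorus) {s : ℝ} (hs0 : 0 < s) (hs1 : s < 3 / 2) : yC (mtPt tubeShearDiffeo x s) = x.2.1 := by
  by_cases h : 1 / 2 < s
  · rw [mtPt_of_mem_two x ⟨h, hs1⟩]; rfl
  · rw [mtPt_of_mem_one x ⟨hs0, by linarith⟩]; rfl

/-- The base angle of `[x, s]`. [folklore] -/
theorem baseC_mtPt (x : ThreeTorus) {s : ℝ} (hs0 : 0 < s) (hs1 : s < 3 / 2) :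
    baseC (mtPt tubeShearDiffeo x s) = Circle.exp (2 * π * s) := by
  by_cases h : 1 / 2 < s
  · rw [mtPt_of_mem_two x ⟨h, hs1⟩]; rfl
  · rw [mtPt_of_mem_one x ⟨hs0, by linarith⟩]; rfl

/-- **The invariants of `mtCoord (v, s)`** (`0 < s < 3/2`): `latC = e^{i(v₀ + v₂)}`, `yC = e^{iv₁}`. [folklore] -/
theorem latC_mtCoord {q : (𝔼 3) × ℝ} (hs0 : 0 < q.2) (hs1 : q.2 < 3 / 2) : latC (mtCoord tubeShearDiffeo q) = Circle.exp (q.1 0 + q.1 2) := by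
  rw [mtCoord, latC_mtPt _ hs0 hs1]
  simp [expT, Circle.exp_add]

/-- The fibre coordinate of `mtCoord (v, s)`. [folklore] -/
theorem yC_mtCoord {q : (𝔼 3) × ℝ} (hs0 : 0 < q.2) (hs1 : q.2 < 3 / 2) : yC (mtCoord tubeShearDiffeo q) = Circle.exp (q.1 1) := by
  rw [mtCoord, yC_mtPt _ hs0 hs1]
  simp [expT]

/-- The base angle of `mtCoord (v, s)`. [folklore] -/
theorem baseC_mtCoord {q : (𝔼 3) × ℝ} (hs0 : 0 < q.2) (hs1 : q.2 < 3 / 2) :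
    baseC (mtCoord tubeShearDiffeo q) = Circle.exp (2 * π * q.2) := by
  rw [mtCoord, baseC_mtPt _ hs0 hs1]

/-! ### Injectivity of `[x, s]` on `[1/2, 3/2)` -/

/-- **`[x, s] = [x', s']` with `s, s' ∈ [1/2, 3/2)` forces `x = x'`, `s = s'`.** [folklore] -/
theorem mtPt_inj_Ico {ψ : ThreeTorus ≃ₘ⟮ModelWithCorners.prod (𝓡 1) (ModelWithCorners.prod (𝓡 1) (𝓡 1)),
    ModelWithCorners.prod (𝓡 1) (ModelWithCorners.prod (𝓡 1) (𝓡 1))⟯ ThreeTorus}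
    {x x' : ThreeTorus} {s s' : ℝ} (hs : 1 / 2 ≤ s ∧ s < 3 / 2) (hs' : 1 / 2 ≤ s' ∧ s' < 3 / 2)
    (h : mtPt ψ x s = mtPt ψ x' s') : x = x' ∧ s = s' := by
  rcases hs.1.lt_or_eq with hlt | heq
  · rcases hs'.1.lt_or_eq with hlt' | heq'
    · exact mtPt_inj_two ⟨hlt, hs.2⟩ ⟨hlt', hs'.2⟩ h
    · -- `s' = 1/2`: `[x', 1/2] = [x, s]` is impossible
      exfalso
      rw [← heq'] at h
      rcases (mtPt_eq_mtPt_iff (by norm_num : (0:ℝ) < 1 / 2 ∧ (1:ℝ) / 2 < 1) ⟨hlt, hs.2⟩).1 h.symm with ⟨h1, -⟩ | ⟨h1, -⟩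
      · linarith
      · norm_num at h1; linarith
  · rcases hs'.1.lt_or_eq with hlt' | heq'
    · exfalso
      rw [← heq] at h
      rcases (mtPt_eq_mtPt_iff (by norm_num : (0:ℝ) < 1 / 2 ∧ (1:ℝ) / 2 < 1) ⟨hlt', hs'.2⟩).1 h with ⟨h1, -⟩ | ⟨h1, -⟩
      · linarith
      · norm_num at h1; linarith
    · rw [← heq, ← heq'] at h ⊢
      exact ⟨(mtPt_inj_one (by norm_num) (by norm_num) h).1, rfl⟩

/-- Equal points have equal invariants (trivial, for `rw` convenience). [folklore] -/
theorem invariants_eq {m m' : MTorus tubeShearDiffeo} (h : m = m') : latC m = latC m' ∧ yC m = yC m' ∧ baseC m = baseC m' := by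
  subst h; exact ⟨rfl, rfl, rfl⟩

/-! ### Recovering angles from circle points -/

/-- `e^{ia} = e^{ib}` with `|a - b| < 2π` forces `a = b`. [folklore] -/
theorem eq_of_circleExp_eq {a b : ℝ} (h : Circle.exp a = Circle.exp b) (hab : |a - b| < 2 * π) : a = b := by
  have h1 : Circle.exp (a - b) = 1 := by rw [Circle.exp_sub, h, div_self']
  rw [Circle.exp_eq_one] at h1
  obtain ⟨m, hm⟩ := h1
  have hπ := Real.pi_pos
  obtain ⟨hl, hr⟩ := abs_lt.1 hab
  rcases lt_trichotomy m 0 with hneg | hzero | hpos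
  · have : (m : ℝ) ≤ -1 := by exact_mod_cast Int.le_sub_one_iff.2 hneg
    nlinarith
  · rw [hzero] at hm; simp at hm; linarith
  · have : (1 : ℝ) ≤ m := by exact_mod_cast hpos
    nlinarith

/-- `e^{ia} = 1` with `|a| < 2π` forces `a = 0`. [folklore] -/
theorem eq_zero_of_circleExp_eq_one {a : ℝ} (h : Circle.exp a = 1) (ha : |a| < 2 * π) : a = 0 := by
  have := eq_of_circleExp_eq (a := a) (b := 0) (by rw [h, Circle.exp_zero]) (by simpa using ha)
  exact this

end Literature.Topology.FourManifolds
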